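/-
Copyright (c) 2026. All rights reserved.
Released under Apache 2.0 license as described in the file LICENSE.
Authors: abc-iut cell — seat abc-iut-w4-d104 (gen 4): [AbsTopIII] Cor 2.9 (b) — the UNIQUENESS half of "the
resulting `ι_{U_X,x}` DETERMINE an isomorphism of topological fields" (INFO item of abc-iut-f-052's
COR29-COUNT-READ, 2026-08-26T12:14Z).
-/
import Literature.AnabelianGeometry.AbsoluteAnabelian.ArchimedeanReconstructionCor29GermEngaged
import HarnessLib

/-!
# [AbsTopIII] Cor 2.9 (b): the isomorphism `𝒜_x ∪ {0} ⥲ k_v` pinned by `ι_{U_X,x}` is UNIQUE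

S. Mochizuki, *Topics in absolute anabelian geometry III* (bib key `MochizukiAbsTopIII2015`), Cor 2.9 (b)
p.65 l.14–22: "the resulting `ι_{U_X,x}` determine an isomorphism of topological fields `𝒜_x ∪ {0} ⥲ k_v` via
the condition of compatibility [with respect to the `ι_{U_X,x}`] with the natural actions of `𝒜_x`, `k_v`".
PROOF-ONLY file (no definitions).  abc-iut-w5-d225's row b.r2 `ScalarFieldIso` (p414208) and abc-iut-L4-t4's
successor statement `GlobalArchimedeanCompatibility'` (p439757) type the EXISTENCE of the pinned isomorphism;
abc-iut-f-052's count read (2026-08-26T12:14Z, INFO) notes that the UNIQUENESS half of "determine" is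
derivable from row b.r1's unique scalar.  Here it is, generically and for the chart packages:

* `Cor29.ScalarFieldIso.apply_eq_of_actionScalar` / `Cor29.ScalarFieldIso.eq_of_actionScalar` — if the action
  of `𝒜_x` has unique scalars on `ι` near `x` (row b.r1 `ActionScalar`), any two isomorphisms `𝒜_x ⥲ k_v^×`
  satisfying row b.r2's pinning clause coincide;
* `Cor29ChartPackage.scalarFieldIso_unique_pkg_of` — along a chart package and for ANY local linear
  holomorphic structure `L` acting through its multipliers, every pinned isomorphism IS
  `(isoUnits x)⁻¹ ≫ κ^×` (= t4's `fieldIsoScalar L x κ`).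

Refereed pre-IUT material; nothing here bears on the disputed [IUTchIII] Cor. 3.12; typed ≠ endorsed.
-/

noncomputable section

namespace Literature.AnabelianGeometry.AbsoluteAnabelian

open _root_.Set _root_.Topology _root_.Filter _root_.Metric _root_.Function

namespace ArchimedeanReconstruction.Cor29

universe u v

variable {X : Type u} [TopologicalSpace X] {𝕜 : Type v} [NontriviallyNormedField 𝕜]
variable {C : Type*} [AddCommGroup C] [Module 𝕜 C]

/-- **Uniqueness of the pinned scalar, pointwise**: if the scalars of the action are unique (row b.r1) and
`e`, `e'` both satisfy the pinning clause of row b.r2, then `e φ = e' φ` for every `φ ∈ 𝒜_x`.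
[cite: MochizukiAbsTopIII2015, Corollary 2.9 (b) p.65] -/
theorem ScalarFieldIso.apply_eq_of_actionScalar {L : LocalLinearHolStructure X} {x : X}
    {act : L.A x → X → X} {ladd : X → X → X} {ι : X → (C →ₗ[𝕜] 𝕜)} {e e' : L.A x ≃ₜ* 𝕜ˣ}
    (hA : ActionScalar (𝕜 := 𝕜) act x ι) (he : ScalarFieldIso L x act ladd ι e)
    (he' : ScalarFieldIso L x act ladd ι e') (φ : L.A x) : e φ = e' φ := by
  obtain ⟨a, -, huniq⟩ := hA φ
  rw [huniq (e φ) (he.1 φ), huniq (e' φ) (he'.1 φ)]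

/-- **Cor 2.9 (b), uniqueness half of "determine"**: given unique scalars (row b.r1), the isomorphism
`𝒜_x ⥲ k_v^×` pinned to `ι_{U_X,x}` by row b.r2 is unique.
[cite: MochizukiAbsTopIII2015, Corollary 2.9 (b) p.65] -/
theorem ScalarFieldIso.eq_of_actionScalar {L : LocalLinearHolStructure X} {x : X}
    {act : L.A x → X → X} {ladd : X → X → X} {ι : X → (C →ₗ[𝕜] 𝕜)} {e e' : L.A x ≃ₜ* 𝕜ˣ}
    (hA : ActionScalar (𝕜 := 𝕜) act x ι) (he : ScalarFieldIso L x act ladd ι e)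
    (he' : ScalarFieldIso L x act ladd ι e') : e = e' :=
  ContinuousMulEquiv.ext fun φ => ScalarFieldIso.apply_eq_of_actionScalar hA he he' φ

end ArchimedeanReconstruction.Cor29

namespace ArchimedeanReconstruction.Cor29ChartPackage

open ArchimedeanReconstruction.Cor29

variable {X : Type} [TopologicalSpace X]
variable {W : Set X} {e : X → ℂ} {e' : ℂ → X} {x : X} {r : ℝ}
variable {𝕜 : Type*} [NontriviallyNormedField 𝕜]

/-- **Along a chart package, for ANY `L`: the pinned isomorphism is unique and equals
`(isoUnits x)⁻¹ ≫ κ^×`** — any `E : 𝒜_x ⥲ k_v^×` satisfying row b.r2 for the multiplier action in the chart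
(with any local addition `ladd`) coincides with the canonical one of `scalarFieldIso_pkg_of` (abc-iut-L4-t4's
`fieldIsoScalar L x κ` when `κu = unitsOfFieldIso κ`). [cite: MochizukiAbsTopIII2015, Corollary 2.9 (b) p.65] -/
theorem scalarFieldIso_unique_pkg_of (L : LocalLinearHolStructure X) (κ : ℂ ≃+* 𝕜) (κu : ℂˣ ≃ₜ* 𝕜ˣ)
    (hκu : ∀ c : ℂˣ, ((κu c : 𝕜ˣ) : 𝕜) = κ c)
    (hr : 0 < r) (hWo : IsOpen W) (hxW : x ∈ W) (he : ContinuousOn e W)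
    (hem : MapsTo e W (ball (e x) r)) (he' : ContinuousOn e' (ball (e x) r))
    (he'm : MapsTo e' (ball (e x) r) W) (hl : ∀ v ∈ W, e' (e v) = v)
    (hrt : ∀ w ∈ ball (e x) r, e (e' w) = w) {ladd : X → X → X} {E : L.A x ≃ₜ* 𝕜ˣ}
    (hE : ScalarFieldIso (𝕜 := 𝕜) L x
      (fun u v => e' (e x + ((((L.isoUnits x).symm u : ℂˣ) : ℂ) * (e v - e x)))) ladd
      (fun v => (κ (e v - e x)) • (LinearMap.id : 𝕜 →ₗ[𝕜] 𝕜)) E) :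
    E = (L.isoUnits x).symm.trans κu := by
  refine ContinuousMulEquiv.ext fun φ => ?_
  obtain ⟨a, -, huniq⟩ := actionScalar_pkg_of L κ κu hκu hr hWo hxW he hem he' he'm hl hrt φ
  have h1 : E φ = a := huniq (E φ) (hE.1 φ)
  have h2 : ((L.isoUnits x).symm.trans κu) φ = a :=
    huniq _ ((scalarFieldIso_pkg_of L κ κu hκu hr hWo hxW he hem he' he'm hl hrt (𝕜 := 𝕜)).1 φ)
  rw [h1, h2]

end ArchimedeanReconstruction.Cor29ChartPackage

end Literature.AnabelianGeometry.AbsoluteAnabelian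

end
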